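import Summits.QuantumFields.YangMills.Theorems.BalabanUVNodesK0Stub1FlatAveragingDictionary
import HarnessLib

/-!
# K0⁷ STUB 1 (`stub_prop8StepCoP13`), sub-target S4a — THE FLAT AVERAGING DICTIONARY, PART 2: **ON LIE-ALGEBRA FIELDS (`qLin k 1`), AT NODE 00's FINE TORUS
# `Site (F.P K) 0`, AND IN THIS SEAT's (128) LETTER `Q_V (twoScale k _ ∅)`** — n07-w1's chart kernel `qLin k 1 X = 0` and the tangent-space hypothesis «`Q_VX = 0`» of
# p593232 ∕ p593935 ∕ p595460 ∕ p596821 ∕ p598323 are gauge transforms of each other by 𝔰𝔲(N)-valued gauge functions (one level, flat background)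

Cell `pub-ymgap`, width seat `pub-ymgap-k0-s1-w1` g3 (INTENT-1, companion of `…K0Stub1FlatAveragingDictionary`).  `--kind proof --supports stmt-QuantumFields-20541 --as helper`;
count-neutral.  [15] = [Balaban1985Variational]; [B5] = [Balaban1984PropagatorsI]; [B6] = [Balaban1984PropagatorsII].

WHAT IS PROVED (sorry-free; no definition; axioms standard).
* §4 ★★ `exists_lieSU_gauge_bondAvgIter_eq_zero_of_qLin_one_eq_zero` — `qLin k 1 X = 0` (`X : bonds → 𝔰𝔲(N)`, `1 ≤ k ≤ m + K`) ⟹ an 𝔰𝔲(N)-valued `μ`, `0` at the `k`-centres,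
  with `Q_k(X + ∂μ) = 0` and `qLin k 1 (X + ∂μ) = 0` (the regauged field is again a Lie-algebra field); ★★ `exists_lieSU_gauge_qLin_one_eq_zero_of_bondAvgIter_eq_zero` —
  `Q_kX = 0` ⟹ the block-constant 𝔰𝔲(N)-valued lift `ν` of the comb functional gives `qLin k 1 (X + ∂ν) = 0`.
* §5 at the record: ★★★ `exists_lieSU_gauge_QV_eq_zero_of_qLin_one_eq_zero_T4` ∕ ★★★ `exists_lieSU_gauge_qLin_one_eq_zero_of_QV_eq_zero_T4` — the same on `Site (F.P K) 0`
  with the constraint written as this seat's `Q_V` (componentwise extension of lit-balaban's one-level `QE (twoScale k _ ∅)`, kernel-formula hypothesis `hQV` of p595460,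
  `DecidableEq` instance unifiable); `dIterL_one_eq_sub_comb_T4` (the dictionary `Q_k(1) = L^k·Q_k − ∂Λ_k` on the record's fine torus, every `k`).
HONEST SCOPE.  As in part 1: flat background, one level ∕ level-wise, linear statements only; which reading S2's chart (47) and the (127)–(128) criticality carry at the record is
S2's decision; nothing of Bałaban's analysis asserted; `stub_prop8StepCoP13` ∕ K0⁷ NOT closed; N07 NOT discharged; counts unmoved (28∕28 · 5∕27); one finite 𝕋⁴ programme at
fixed ε — R4 closes the conditional finite-𝕋⁴ rung `BalabanLadder.UV` only, never the summit; the YM mass gap (Clay) is NOT proved by any of this; nothing continuum ∕ ℝ⁴ ∕ OS.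
No `sorry`, no `def`, no `instance`, no `notation`.

References: [15] (4) p.278, (44)–(47) p.285, (156)–(157) p.302; [B5] (1.18)–(1.20) p.20; [B6] (2.20) p.226, (2.90) p.239; [Balaban1985Averaging] (11) p.18, (62) p.28;
[Balaban1988Convergent] (2.11) p.256.
-/

set_option autoImplicit false
noncomputable section
open scoped BigOperators Matrix

namespace Summit.QuantumFields.YangMills.Theorems.K0Stub1FlatAveragingDictionaryAtRecord

open Literature.MathematicalPhysics.QuantumFieldTheory.Balaban1983to89
open Literature.MathematicalPhysics.QuantumFieldTheory.Balaban1983to89.T4Continuum (T4Family)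
open LatticeFieldCalculus (bondAvgIter siteAvgIter grad)
open BlockAveragingEMLLinearised (linAvg walkSum combMean)
open B5Eq118OneStroke (iterBlockOf)
open B15DeterminingSets (embIter)
open T4AdjointCovarianceUnitary (lieSU mem_lieSU_iff)
open Node00 (SU dIterL qLin)
open B6SectADomainsV1 (Domains)
open B6SectAOperatorsV1 (BondIdx QE)
open B6SectCTwoScaleV1 (twoScale)
open Summit.QuantumFields.YangMills.Theorems.ChartHInv (exists_linFamily)
open Summit.QuantumFields.YangMills.Theorems.K0Stub1FlatAveragingDictionary

variable {P : Params} {N : ℕ}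

/-! ## §4  ON LIE-ALGEBRA FIELDS (`X : bonds → 𝔰𝔲(N)`, n07-w1's `qLin k 1` and dag-n10-w1's chart-derivative currency): the regauged field is again a Lie-algebra field -/

section LieSU

variable [NeZero N]

/-- ★★ **`qLin k 1 X = 0` ⟹ a (4)-gauge transform `X + ∂μ` of `X` BY AN 𝔰𝔲(N)-VALUED `μ` VANISHING AT THE `k`-CENTRES HAS VANISHING STRAIGHT AVERAGE `Q_k`** (and still
`qLin k 1 (X + ∂μ) = 0`), `1 ≤ k ≤ m + K`. [cite: Balaban1985Variational, (4) p.278, (44)-(45) p.285; Balaban1984PropagatorsI, (1.18) p.20] -/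
theorem exists_lieSU_gauge_bondAvgIter_eq_zero_of_qLin_one_eq_zero {k : ℕ} (hk : k ≤ P.m + P.K) (hk1 : 1 ≤ k)
    (X : PBond P 0 → lieSU (Fin N)) (h0 : qLin k (1 : GaugeField P 0 (SU N)) X = 0) :
    ∃ μ : Site P 0 → lieSU (Fin N), (∀ y : Site P k, μ (embIter k y) = 0) ∧
      (∀ c : PBond P k, bondAvgIter k (fun b => ((X b + (μ b.tgt - μ b.src) : lieSU (Fin N)) : Matrix (Fin N) (Fin N) ℂ)) c = 0) ∧
      qLin k (1 : GaugeField P 0 (SU N)) (fun b => X b + (μ b.tgt - μ b.src)) = 0 := by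
  obtain ⟨Q, hQ0, hQs⟩ := exists_linFamily (P := P) (n := Fin N)
  have hX : ∀ b, star ((X b : lieSU (Fin N)) : Matrix (Fin N) (Fin N) ℂ) = -((X b : lieSU (Fin N)) : Matrix (Fin N) (Fin N) ℂ) :=
    fun b => (mem_lieSU_iff.1 (X b).2).1
  have h0' : ∀ c : PBond P k, dIterL k (1 : PBond P 0 → Matrix (Fin N) (Fin N) ℂ) (fun b => (X b : Matrix (Fin N) (Fin N) ℂ)) c = 0 := fun c => by
    rw [← Node00.qLin_one_apply k X c, h0, Pi.zero_apply]
  obtain ⟨lam, -, hcentre, hQ, hker, hsu⟩ := exists_gauge_bondAvgIter_eq_zero_of_dIterL_one_eq_zero hk hk1 hX h0'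
  have hmem : ∀ x, lam x ∈ lieSU (Fin N) := hsu fun b => (X b).2
  refine ⟨fun x => ⟨lam x, hmem x⟩, fun y => Subtype.ext (hcentre y), fun c => ?_, ?_⟩
  · simp only [Submodule.coe_add, Submodule.coe_sub]
    exact hQ c
  · funext c
    rw [Node00.qLin_one_apply, Pi.zero_apply]
    simp only [Submodule.coe_add, Submodule.coe_sub]
    exact hker c

/-- ★★ **`Q_k X = 0` (straight average) ⟹ the block-constant 𝔰𝔲(N)-valued lift `ν` of the comb functional regauges `X` into n07-w1's kernel: `qLin k 1 (X + ∂ν) = 0`**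
(`k ≤ m + K`). [cite: Balaban1985Variational, (44)-(45) p.285; Balaban1984PropagatorsI, (1.18) p.20; Balaban1985Averaging, (62) p.28] -/
theorem exists_lieSU_gauge_qLin_one_eq_zero_of_bondAvgIter_eq_zero {k : ℕ} (hk : k ≤ P.m + P.K)
    (X : PBond P 0 → lieSU (Fin N)) (h0 : ∀ c : PBond P k, bondAvgIter k (fun b => (X b : Matrix (Fin N) (Fin N) ℂ)) c = 0) :
    ∃ ν : Site P 0 → lieSU (Fin N), (∀ x, ν x = ν (embIter k (iterBlockOf k x))) ∧
      qLin k (1 : GaugeField P 0 (SU N)) (fun b => X b + (ν b.tgt - ν b.src)) = 0 := by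
  have hX : ∀ b, star ((X b : lieSU (Fin N)) : Matrix (Fin N) (Fin N) ℂ) = -((X b : lieSU (Fin N)) : Matrix (Fin N) (Fin N) ℂ) :=
    fun b => (mem_lieSU_iff.1 (X b).2).1
  obtain ⟨nu, -, hconst, hker, hsu⟩ := exists_gauge_dIterL_one_eq_zero_of_bondAvgIter_eq_zero hk hX h0
  have hmem : ∀ x, nu x ∈ lieSU (Fin N) := hsu fun b => (X b).2
  refine ⟨fun x => ⟨nu x, hmem x⟩, fun x => Subtype.ext (hconst x), ?_⟩
  funext c
  rw [Node00.qLin_one_apply, Pi.zero_apply]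
  simp only [Submodule.coe_add, Submodule.coe_sub]
  exact hker c

end LieSU

/-! ## §5  AT NODE 00's RECORD (`Site (F.P K) 0`) AND IN THIS SEAT's (128) LETTERS: the one-level `Q_V (twoScale k _ ∅)` of p598323 vs n07-w1's `qLin k 1` -/

section Record128

open Summit.QuantumFields.YangMills.Theorems.K0Stub1FlatPropagatorsExistAtRecord (succ_le_m_add_K)

variable [NeZero N]

/-- ★★★ **THE ONE-LEVEL DICTIONARY BETWEEN THE TWO TANGENT-SPACE READINGS AT THE RECORD.**  On the fine torus `Site (F.P K) 0` (`1 ≤ k`, `k + 1 ≤ m + K`), for `Q_V` the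
componentwise extension of lit-balaban's one-level `QE (twoScale k _ ∅)` (the test-class letter of p593232∕p593935∕p595460∕p596821∕p598323) and n07-w1's `qLin k 1` (the letter of
5c `fderiv_msChart_apply_eq_zero_iff` ∕ dag-n10-w1's `fderiv_msChart_one_apply_eq_iterLin` at the flat datum): every Lie-algebra field `X` with `qLin k 1 X = 0` has a
(4)-gauge transform `X + ∂μ` (`μ` 𝔰𝔲(N)-valued, `0` at the `k`-centres) with `Q_V(X + ∂μ) = 0` and `qLin k 1 (X + ∂μ) = 0`.
[cite: Balaban1985Variational, (4) p.278, (44)-(45) p.285, (156)-(157) p.302; Balaban1984PropagatorsII, (2.20) p.226, (2.90) p.239] -/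
theorem exists_lieSU_gauge_QV_eq_zero_of_qLin_one_eq_zero_T4 (F : T4Family) (K k : ℕ) (hk1 : k + 1 ≤ F.m + K) (hk : 1 ≤ k)
    {instDE : DecidableEq (PBond (F.P K) 0)}
    {QV : (PBond (F.P K) 0 → Matrix (Fin N) (Fin N) ℂ) →ₗ[ℂ]
      (BondIdx (twoScale k (succ_le_m_add_K F K k hk1) (∅ : Finset (Site (F.P K) (k + 1)))) → Matrix (Fin N) (Fin N) ℂ)}
    (hQV : ∀ (A : PBond (F.P K) 0 → Matrix (Fin N) (Fin N) ℂ) (t : BondIdx (twoScale k (succ_le_m_add_K F K k hk1) (∅ : Finset (Site (F.P K) (k + 1))))),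
      QV A t = ∑ j, ((WithLp.ofLp (QE (twoScale k (succ_le_m_add_K F K k hk1) ∅) (WithLp.toLp 2 (Pi.single j 1))) t : ℝ) : ℂ) • A j)
    (X : PBond (F.P K) 0 → lieSU (Fin N)) (h0 : qLin k (1 : GaugeField (F.P K) 0 (SU N)) X = 0) :
    ∃ μ : Site (F.P K) 0 → lieSU (Fin N), (∀ y : Site (F.P K) k, μ (embIter k y) = 0) ∧
      QV (fun b => ((X b + (μ b.tgt - μ b.src) : lieSU (Fin N)) : Matrix (Fin N) (Fin N) ℂ)) = 0 ∧
      qLin k (1 : GaugeField (F.P K) 0 (SU N)) (fun b => X b + (μ b.tgt - μ b.src)) = 0 := by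
  obtain ⟨μ, hcentre, hQ, hker⟩ := exists_lieSU_gauge_bondAvgIter_eq_zero_of_qLin_one_eq_zero (P := F.P K)
    (Nat.le_of_succ_le (succ_le_m_add_K F K k hk1)) hk X h0
  exact ⟨μ, hcentre, (QV_twoScale_eq_zero_iff (succ_le_m_add_K F K k hk1) hQV _).2 hQ, hker⟩

/-- ★★★ **… AND BACK**: every Lie-algebra field `X` with `Q_VX = 0` (this seat's (128) test class at one level) has a gauge transform `X + ∂ν` (`ν` 𝔰𝔲(N)-valued, constant on
`k`-blocks) in n07-w1's kernel: `qLin k 1 (X + ∂ν) = 0` (`k + 1 ≤ m + K`). [cite: Balaban1985Variational, (44)-(45) p.285, (156)-(157) p.302; Balaban1984PropagatorsII, (2.20) p.226] -/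
theorem exists_lieSU_gauge_qLin_one_eq_zero_of_QV_eq_zero_T4 (F : T4Family) (K k : ℕ) (hk1 : k + 1 ≤ F.m + K)
    {instDE : DecidableEq (PBond (F.P K) 0)}
    {QV : (PBond (F.P K) 0 → Matrix (Fin N) (Fin N) ℂ) →ₗ[ℂ]
      (BondIdx (twoScale k (succ_le_m_add_K F K k hk1) (∅ : Finset (Site (F.P K) (k + 1)))) → Matrix (Fin N) (Fin N) ℂ)}
    (hQV : ∀ (A : PBond (F.P K) 0 → Matrix (Fin N) (Fin N) ℂ) (t : BondIdx (twoScale k (succ_le_m_add_K F K k hk1) (∅ : Finset (Site (F.P K) (k + 1))))),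
      QV A t = ∑ j, ((WithLp.ofLp (QE (twoScale k (succ_le_m_add_K F K k hk1) ∅) (WithLp.toLp 2 (Pi.single j 1))) t : ℝ) : ℂ) • A j)
    (X : PBond (F.P K) 0 → lieSU (Fin N)) (h0 : QV (fun b => (X b : Matrix (Fin N) (Fin N) ℂ)) = 0) :
    ∃ ν : Site (F.P K) 0 → lieSU (Fin N), (∀ x, ν x = ν (embIter k (iterBlockOf k x))) ∧
      qLin k (1 : GaugeField (F.P K) 0 (SU N)) (fun b => X b + (ν b.tgt - ν b.src)) = 0 :=
  exists_lieSU_gauge_qLin_one_eq_zero_of_bondAvgIter_eq_zero (P := F.P K) (Nat.le_of_succ_le (succ_le_m_add_K F K k hk1)) X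
    ((QV_twoScale_eq_zero_iff (succ_le_m_add_K F K k hk1) hQV _).1 h0)

/-- ★ At NODE 00's record: the dictionary `Q_k(1)Y = L^k·Q_kY − ∂Λ_k(Y)` on skew fields of the fine torus `Site (F.P K) 0`, every `k` (no range hypothesis).
[cite: Balaban1985Variational, (44)-(47) p.285; Balaban1988Convergent, (2.11) p.256] -/
theorem dIterL_one_eq_sub_comb_T4 (F : T4Family) (K : ℕ)
    (Λ : (i : ℕ) → (PBond (F.P K) 0 → Matrix (Fin N) (Fin N) ℂ) → Site (F.P K) i → Matrix (Fin N) (Fin N) ℂ)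
    (hΛ0 : ∀ Y y, Λ 0 Y y = 0)
    (hΛs : ∀ (i : ℕ) (Y : PBond (F.P K) 0 → Matrix (Fin N) (Fin N) ℂ) (y : Site (F.P K) (i + 1)),
      Λ (i + 1) Y y = ((F.P K).L ^ i : ℕ) • combMean (bondAvgIter i Y) y + Λ i Y (emb y))
    {Y : PBond (F.P K) 0 → Matrix (Fin N) (Fin N) ℂ} (hY : ∀ b, star (Y b) = -Y b) (k : ℕ) (c : PBond (F.P K) k) :
    dIterL k (1 : PBond (F.P K) 0 → Matrix (Fin N) (Fin N) ℂ) Y c = ((F.P K).L ^ k : ℕ) • bondAvgIter k Y c - (Λ k Y c.tgt - Λ k Y c.src) :=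
  dIterL_one_eq_sub_comb Λ hΛ0 hΛs hY k c

end Record128

end Summit.QuantumFields.YangMills.Theorems.K0Stub1FlatAveragingDictionaryAtRecord

end
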